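import Mathlib
import Summits.Ventures.HodgeRepro2.T6N1WitGram
import Summits.Ventures.HodgeRepro2.T6N1Main

/-!
# T6N1WitGram2 — the dictionary `sc` with PROPORTIONAL `f_B = λ • f_A`, its Gram functional, and the monomial
case of the Petersson display (the non-degenerate N1 instance, STATUS l. 11284 (S4)–(S5) + the lead's l. 11351
(2)(α); owner t6-p1, gen 3)

t6-p3's proportionality boundary (T6N3TrivGroup v2, l. 11339 (1)) requires the two automorphic vectors of the
N3 toy to span the same line: `sc ω_B = λ • sc ω_A`. With `sc` orthonormal on the first-copy pairs (T6N1WitGram's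
`sc`) the adjoint vector `sc e_{q_B}` has one component per first-copy pair `p` with `λ₁(e_p · conj2 e_{q_B}) ≠ 0`
— in general several. Here the dictionary is re-cut by a rank factorisation: with `M p q := λ₁(e_p · conj2 e_q)`,
`p_A` / `q_B` the pair monomials of `ω_A` / `ω_B` and `M₀ := M p_A q_B ≠ 0` (the period), the first-copy pairs
go to `g_p := (M p q_B / M₀) • f_{p_A} + [p ≠ p_A] f_p` and the second-copy pairs to
`h_q := Σ_p conj(β q p) • f_p` with `β q p_A := M p_A q`, `β q p := M p q − M p_A q · (M p q_B / M₀)`; then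
`⟪h_q, g_p⟫ = M p q` (the `(★)` block, `inner_scP_eS`) and `h_{q_B} = conj M₀ • f_{p_A} = conj M₀ • g_{p_A}`
(`scValP_qB`). The Gram functional `λ₂ := λ₂raw ∘ (id − projL)` and the monomial identity
`(λ₁ + λ₂)(e_p · conj2 e_q) = ⟪sc e_q, sc e_p⟫` follow as before in T6N1WitGram3 (`intS_eS_pairP`). No `sorry`;
standard axioms.
§8(d): uses an L-value-free non-vanishing device: NO.
-/

namespace Summit.Ventures.HodgeRepro2.T6.N1Wit

open ExteriorAlgebra Conj Set.powersetCard NumberField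
open scoped InnerProductSpace

variable {K : Type} [Field K] [NumberField K] {F : FaceSetting K} (D : WitData F) (σ₀ : K →+* ℂ)

namespace WitData

/-! ## 1. The two vertex pairs of `σ₀` and their pair monomials -/

/-- The complement of a balanced pair: `σ₀` misses exactly two of the four CM types. -/
theorem exists_pair_notMem (F : FaceSetting K) (σ : K →+* ℂ) :
    ∃ a b : Fin 4, a < b ∧ ∀ i, σ ∉ F.T i ↔ i = a ∨ i = b := by
  classical
  have hcard : (Finset.univ.filter fun i : Fin 4 => σ ∈ F.T i).card = 2 := by
    have := F.face.2 σ
    rw [Nat.card_eq_fintype_card, Fintype.card_subtype] at this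
    exact this
  have hcard' : (Finset.univ.filter fun i : Fin 4 => σ ∉ F.T i).card = 2 := by
    have h := Finset.card_filter_add_card_filter_not
      (s := (Finset.univ : Finset (Fin 4))) (fun i : Fin 4 => σ ∈ F.T i)
    rw [hcard, Finset.card_univ, Fintype.card_fin] at h
    omega
  obtain ⟨a, b, hab, hset⟩ := Finset.card_eq_two.1 hcard'
  have hmem : ∀ i : Fin 4, σ ∉ F.T i ↔ i = a ∨ i = b := by
    intro i
    have := Finset.ext_iff.1 hset i
    simpa [Finset.mem_filter, Finset.mem_insert, Finset.mem_singleton] using this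
  rcases lt_or_gt_of_ne hab with h | h
  · exact ⟨a, b, h, hmem⟩
  · exact ⟨b, a, h, fun i => (hmem i).trans or_comm⟩

/-- The vertex pair `(i_A, j_A)` with `σ₀ ∈ T`. -/
noncomputable def pairA : {p : Fin 4 × Fin 4 // p.1 < p.2 ∧ ∀ i, σ₀ ∈ F.T i ↔ i = p.1 ∨ i = p.2} :=
  Classical.choice (by
    obtain ⟨a, b, hab, h⟩ := N1Main.exists_pair_of_face F σ₀
    exact ⟨⟨(a, b), hab, h⟩⟩)

/-- The vertex pair `(k_B, l_B)` with `σ₀ ∉ T`. -/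
noncomputable def pairB : {p : Fin 4 × Fin 4 // p.1 < p.2 ∧ ∀ i, σ₀ ∉ F.T i ↔ i = p.1 ∨ i = p.2} :=
  Classical.choice (by
    obtain ⟨a, b, hab, h⟩ := exists_pair_notMem F σ₀
    exact ⟨⟨(a, b), hab, h⟩⟩)

/-- An ordered pair of vertices with `σ₀ ∈ T` is `(i_A, j_A)`. -/
theorem eq_pairA {i j : Fin 4} (hij : i < j) (hi : σ₀ ∈ F.T i) (hj : σ₀ ∈ F.T j) :
    i = (pairA (F := F) σ₀).1.1 ∧ j = (pairA (F := F) σ₀).1.2 := by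
  obtain ⟨⟨a, b⟩, hab, h⟩ := pairA (F := F) σ₀
  simp only at hab h ⊢
  rcases (h i).1 hi with rfl | rfl <;> rcases (h j).1 hj with rfl | rfl
  · exact absurd hij (lt_irrefl _)
  · exact ⟨rfl, rfl⟩
  · exact absurd (hab.trans hij) (lt_irrefl _)
  · exact absurd hij (lt_irrefl _)

/-- An ordered pair of vertices with `σ₀ ∉ T` is `(k_B, l_B)`. -/
theorem eq_pairB {k l : Fin 4} (hkl : k < l) (hk : σ₀ ∉ F.T k) (hl : σ₀ ∉ F.T l) :
    k = (pairB (F := F) σ₀).1.1 ∧ l = (pairB (F := F) σ₀).1.2 := by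
  obtain ⟨⟨a, b⟩, hab, h⟩ := pairB (F := F) σ₀
  simp only at hab h ⊢
  rcases (h k).1 hk with rfl | rfl <;> rcases (h l).1 hl with rfl | rfl
  · exact absurd hkl (lt_irrefl _)
  · exact ⟨rfl, rfl⟩
  · exact absurd (hab.trans hkl) (lt_irrefl _)
  · exact absurd hkl (lt_irrefl _)

/-- The first-copy index of the vertex `i` at `σ₀`. -/
noncomputable def aL (i : Fin 4) : Fin (nJ K) := idx K (Sum.inl (i, σ₀))

/-- The second-copy index of the vertex `i` at `\bar σ₀`. -/
noncomputable def aR (i : Fin 4) : Fin (nJ K) := idx K (Sum.inr (i, ComplexEmbedding.conjugate σ₀))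

/-- `aL` is injective. -/
theorem aL_injective : Function.Injective (aL (K := K) σ₀) := by
  intro i j h
  have := (idx K).injective h
  simpa using this

/-- `aR` is injective. -/
theorem aR_injective : Function.Injective (aR (K := K) σ₀) := by
  intro i j h
  have := (idx K).injective h
  simpa using this

/-- `C (aR i) = aL i`. -/
theorem Cidx_aR (i : Fin 4) : Cidx K (aR σ₀ i) = aL σ₀ i := by
  rw [Cidx, aR, Equiv.symm_apply_apply, Cj, aL]
  simp

/-- The pair monomial index of `ω_A`. -/
noncomputable def pA : Finset (Fin (nJ K)) := {aL σ₀ (pairA (F := F) σ₀).1.1, aL σ₀ (pairA (F := F) σ₀).1.2}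

/-- The pair monomial index of `ω_B`. -/
noncomputable def qB : Finset (Fin (nJ K)) := {aR σ₀ (pairB (F := F) σ₀).1.1, aR σ₀ (pairB (F := F) σ₀).1.2}

/-- `p_A` is a first-copy `U`-pair. -/
theorem pA_mem_pairs1 : pA (F := F) σ₀ ∈ pairs1 F := by
  classical
  have hne : (pairA (F := F) σ₀).1.1 ≠ (pairA (F := F) σ₀).1.2 := (pairA (F := F) σ₀).2.1.ne
  refine Finset.mem_filter.2 ⟨mem_pairs.2 ⟨?_, Finset.card_pair ((aL_injective σ₀).ne hne)⟩, ?_⟩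
  · intro x hx
    rw [pA, Finset.mem_insert, Finset.mem_singleton] at hx
    rcases hx with rfl | rfl
    · exact (idx_inl_mem_IU _ _).2 (((pairA (F := F) σ₀).2.2 _).2 (Or.inl rfl))
    · exact (idx_inl_mem_IU _ _).2 (((pairA (F := F) σ₀).2.2 _).2 (Or.inr rfl))
  · intro x hx
    rw [pA, Finset.mem_insert, Finset.mem_singleton] at hx
    rcases hx with rfl | rfl <;> exact idx_inl_mem_Iinl _

/-- `q_B` is a second-copy `U`-pair. -/
theorem qB_mem_pairs3 : qB (F := F) σ₀ ∈ pairs3 F := by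
  classical
  have hne : (pairB (F := F) σ₀).1.1 ≠ (pairB (F := F) σ₀).1.2 := (pairB (F := F) σ₀).2.1.ne
  have hmem : ∀ k, σ₀ ∉ F.T k → ComplexEmbedding.conjugate σ₀ ∈ F.T k := fun k hk =>
    ((F.face.1 k σ₀).resolve_left fun h => hk h.1).1
  refine Finset.mem_filter.2 ⟨mem_pairs.2 ⟨?_, Finset.card_pair ((aR_injective σ₀).ne hne)⟩, ?_⟩
  · intro x hx
    rw [qB, Finset.mem_insert, Finset.mem_singleton] at hx
    rcases hx with rfl | rfl
    · exact (idx_inr_mem_IU _ _).2 (hmem _ (((pairB (F := F) σ₀).2.2 _).2 (Or.inl rfl)))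
    · exact (idx_inr_mem_IU _ _).2 (hmem _ (((pairB (F := F) σ₀).2.2 _).2 (Or.inr rfl)))
  · rw [Finset.disjoint_left]
    intro x hx
    rw [qB, Finset.mem_insert, Finset.mem_singleton] at hx
    rcases hx with rfl | rfl <;> exact idx_inr_notMem_Iinl _

/-- `p_A ∪ C q_B` is the first-copy image of all four vertices at `σ₀`. -/
theorem pA_union_Cset_qB :
    pA (F := F) σ₀ ∪ Cset (qB (F := F) σ₀) = Finset.univ.image (aL σ₀) := by
  classical
  ext x
  simp only [pA, qB, Cset, Finset.mem_union, Finset.mem_insert, Finset.mem_singleton,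
    Finset.mem_image, Finset.mem_univ, true_and, Finset.image_insert, Finset.image_singleton, Cidx_aR]
  constructor
  · rintro ((rfl | rfl) | (rfl | rfl)) <;> exact ⟨_, rfl⟩
  · rintro ⟨i, rfl⟩
    by_cases hi : σ₀ ∈ F.T i
    · rcases ((pairA (F := F) σ₀).2.2 i).1 hi with rfl | rfl
      · exact Or.inl (Or.inl rfl)
      · exact Or.inl (Or.inr rfl)
    · rcases ((pairB (F := F) σ₀).2.2 i).1 hi with rfl | rfl
      · exact Or.inr (Or.inl rfl)
      · exact Or.inr (Or.inr rfl)

/-! ## 2. The period as a monomial coefficient: `M₀ ≠ 0` -/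

/-- The four first-copy indices at `σ₀`. -/
noncomputable def S4 : Finset (Fin (nJ K)) := {aL σ₀ 0, aL σ₀ 1, aL σ₀ 2, aL σ₀ 3}

/-- `S4` is the image of all four vertices. -/
theorem image_aL_eq_S4 : Finset.univ.image (aL σ₀) = S4 σ₀ := by
  ext x
  simp only [Finset.mem_image, Finset.mem_univ, true_and, S4, Finset.mem_insert, Finset.mem_singleton]
  constructor
  · rintro ⟨i, rfl⟩
    fin_cases i <;> simp
  · rintro (rfl | rfl | rfl | rfl) <;> exact ⟨_, rfl⟩

/-- The product of the four first-copy generators at `σ₀` is a sign times `e_{S4}`. -/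
theorem prod_aL_eq_smul_eS :
    ∃ u : ℤˣ, D.eS {aL σ₀ 0} * D.eS {aL σ₀ 1} * D.eS {aL σ₀ 2} * D.eS {aL σ₀ 3} = u • D.eS (S4 σ₀) := by
  have hinj := aL_injective (K := K) σ₀
  have h01 : Disjoint ({aL σ₀ 0} : Finset (Fin (nJ K))) {aL σ₀ 1} :=
    Finset.disjoint_singleton.2 (hinj.ne (by decide))
  have h012 : Disjoint ({aL σ₀ 0} ∪ {aL σ₀ 1} : Finset (Fin (nJ K))) {aL σ₀ 2} := by
    rw [Finset.disjoint_union_left]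
    exact ⟨Finset.disjoint_singleton.2 (hinj.ne (by decide)),
      Finset.disjoint_singleton.2 (hinj.ne (by decide))⟩
  have h0123 : Disjoint ({aL σ₀ 0} ∪ {aL σ₀ 1} ∪ {aL σ₀ 2} : Finset (Fin (nJ K))) {aL σ₀ 3} := by
    rw [Finset.disjoint_union_left, Finset.disjoint_union_left]
    exact ⟨⟨Finset.disjoint_singleton.2 (hinj.ne (by decide)),
      Finset.disjoint_singleton.2 (hinj.ne (by decide))⟩,
      Finset.disjoint_singleton.2 (hinj.ne (by decide))⟩
  obtain ⟨u1, hu1⟩ := D.eS_mul_eS_of_disjoint h01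
  obtain ⟨u2, hu2⟩ := D.eS_mul_eS_of_disjoint h012
  obtain ⟨u3, hu3⟩ := D.eS_mul_eS_of_disjoint h0123
  have hS : ({aL σ₀ 0} ∪ {aL σ₀ 1} ∪ {aL σ₀ 2} ∪ {aL σ₀ 3} : Finset (Fin (nJ K))) = S4 σ₀ := by
    ext x
    simp only [Finset.mem_union, Finset.mem_singleton, S4, Finset.mem_insert]
    tauto
  refine ⟨u1 * u2 * u3, ?_⟩
  rw [hu1, smul_mul_assoc, hu2, smul_mul_assoc, smul_mul_assoc, hu3, smul_smul, smul_smul, hS]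

/-- `λ₁ (e_{S4})` is (a sign times) the period `∫_S f^*(e_0 ∧ e_1 ∧ e_2 ∧ e_3) ≠ 0`. -/
theorem lam1_eS_S4_ne_zero : lam1 (D.heK σ₀) (D.eS (S4 σ₀)) ≠ 0 := by
  obtain ⟨u, hu⟩ := D.prod_aL_eq_smul_eS σ₀
  have hunit : ((u : ℤ) : ℂ) ≠ 0 := by exact_mod_cast u.ne_zero
  have hprod : D.eS {aL σ₀ 0} * D.eS {aL σ₀ 1} * D.eS {aL σ₀ 2} * D.eS {aL σ₀ 3} =
      pull2 (ToyN.eigenMon (D.eK σ₀)) := by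
    simp only [D.eS_singleton, aL, D.bI_inl, ToyN.eigenMon, map_mul, pull2_ι, ToyN.eVec, D.heB,
      LinearMap.single_apply]
  have h := congrArg (lam1 (D.heK σ₀)) hu
  rw [hprod, lam1_pull2, units_smul_eq, map_smul, smul_eq_mul] at h
  have hne : ToyN.intSN (D.heK σ₀) (ToyN.eigenMon (D.eK σ₀)) ≠ 0 := by
    rw [ToyN.intSN_apply, ToyN.extC_zN]
    exact ToyN.sN_spec (D.heK σ₀)
  intro h0
  rw [h0, mul_zero] at h
  exact hne h

/-- The block matrix `M p q := λ₁(e_p · conj2 e_q)`. -/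
noncomputable def M (p q : Finset (Fin (nJ K))) : ℂ := lam1 (D.heK σ₀) (D.eS p * conj2 (D.eS q))

/-- `M₀ := M p_A q_B`. -/
noncomputable def M0 : ℂ := D.M σ₀ (pA (F := F) σ₀) (qB (F := F) σ₀)

/-- `M₀ ≠ 0` — the period. -/
theorem M0_ne_zero : D.M0 σ₀ ≠ 0 := by
  have hp : pA (F := F) σ₀ ∈ pairs F := (Finset.mem_filter.1 (pA_mem_pairs1 σ₀)).1
  have hq : qB (F := F) σ₀ ∈ pairs F := (Finset.mem_filter.1 (qB_mem_pairs3 σ₀)).1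
  rw [M0, M, D.prod_eS_eq_sPQ_smul hp hq, map_smul, smul_eq_mul]
  refine mul_ne_zero (D.sPQ_ne_zero hp hq) ?_
  rw [SPQ, pA_union_Cset_qB, image_aL_eq_S4]
  exact D.lam1_eS_S4_ne_zero σ₀

/-! ## 3. The dictionary with proportional vectors -/

/-- `a p := M p q_B / M₀`. -/
noncomputable def aCoef (p : Finset (Fin (nJ K))) : ℂ := D.M σ₀ p (qB (F := F) σ₀) / D.M0 σ₀

/-- `a p_A = 1`. -/
theorem aCoef_pA : D.aCoef σ₀ (pA (F := F) σ₀) = 1 := by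
  rw [aCoef]
  exact div_self (D.M0_ne_zero σ₀)

open Classical in
/-- `β q p`: the coordinates of the second-copy vectors. -/
noncomputable def beta (q p : Finset (Fin (nJ K))) : ℂ :=
  if p = pA (F := F) σ₀ then D.M σ₀ (pA (F := F) σ₀) q
  else D.M σ₀ p q - D.M σ₀ (pA (F := F) σ₀) q * D.aCoef σ₀ p

open Classical in
/-- The values of the proportional dictionary on monomials. -/
noncomputable def scValP (S : Finset (Fin (nJ K))) : LGw K :=
  if S ∈ pairs1 F then D.aCoef σ₀ S • fvec (pA (F := F) σ₀) + (if S = pA (F := F) σ₀ then 0 else fvec S)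
  else if S ∈ pairs3 F then ∑ p ∈ pairs1 F, (starRingEnd ℂ (D.beta σ₀ S p)) • fvec p
  else 0

/-- THE DICTIONARY `sc` (proportional version). -/
noncomputable def scP : HS2 K →ₗ[ℂ] LGw K := D.bI.ExteriorAlgebra.constr ℂ (D.scValP σ₀)

/-- `sc` on monomials. -/
theorem scP_eS (S : Finset (Fin (nJ K))) : D.scP σ₀ (D.eS S) = D.scValP σ₀ S :=
  Module.Basis.constr_basis _ _ _ _

/-- `sc e_{p_A} = f_{p_A}`. -/
theorem scValP_pA : D.scValP σ₀ (pA (F := F) σ₀) = fvec (pA (F := F) σ₀) := by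
  classical
  rw [scValP, if_pos (pA_mem_pairs1 σ₀), if_pos rfl, aCoef_pA, one_smul, add_zero]

/-- A second-copy pair is not a first-copy pair. -/
theorem notMem_pairs1_of_mem_pairs3 {q : Finset (Fin (nJ K))} (hq : q ∈ pairs3 F) : q ∉ pairs1 F := by
  classical
  intro hq1
  have hsub := (Finset.mem_filter.1 hq1).2
  have hdisj := (Finset.mem_filter.1 hq).2
  have hcard := (mem_pairs.1 (Finset.mem_filter.1 hq).1).2
  have : q = ∅ := (Finset.disjoint_self_iff_empty q).1 (hdisj.symm.mono_left hsub)
  rw [this, Finset.card_empty] at hcard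
  exact absurd hcard (by norm_num)

/-- `sc e_{q_B} = conj M₀ • f_{p_A}`. -/
theorem scValP_qB : D.scValP σ₀ (qB (F := F) σ₀) = (starRingEnd ℂ (D.M0 σ₀)) • fvec (pA (F := F) σ₀) := by
  classical
  have hq3 := qB_mem_pairs3 (F := F) σ₀
  rw [scValP, if_neg (notMem_pairs1_of_mem_pairs3 hq3), if_pos hq3]
  rw [Finset.sum_eq_single_of_mem (pA (F := F) σ₀) (pA_mem_pairs1 σ₀)]
  · rw [beta, if_pos rfl]
    rfl
  · intro p hp hne
    have h0 := D.M0_ne_zero σ₀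
    have hz : D.M σ₀ p (qB (F := F) σ₀) - D.M σ₀ (pA (F := F) σ₀) (qB (F := F) σ₀) *
        D.aCoef σ₀ p = 0 := by
      rw [aCoef, show D.M σ₀ (pA (F := F) σ₀) (qB (F := F) σ₀) = D.M0 σ₀ from rfl]
      field_simp
      ring
    rw [beta, if_neg hne, hz, map_zero, zero_smul]

/-- The `(★)` block: `⟪sc e_q, sc e_p⟫ = M p q` for a first-copy `p` and a second-copy `q`. -/
theorem inner_scP_eS {p q : Finset (Fin (nJ K))} (hp : p ∈ pairs1 F) (hq : q ∈ pairs3 F) :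
    ⟪D.scP σ₀ (D.eS q), D.scP σ₀ (D.eS p)⟫_ℂ = D.M σ₀ p q := by
  classical
  rw [D.scP_eS, D.scP_eS, scValP, scValP, if_pos hp, if_neg (notMem_pairs1_of_mem_pairs3 hq), if_pos hq,
    sum_inner]
  have hterm : ∀ p' ∈ pairs1 F,
      ⟪(starRingEnd ℂ (D.beta σ₀ q p')) • fvec p',
        D.aCoef σ₀ p • fvec (pA (F := F) σ₀) + (if p = pA (F := F) σ₀ then 0 else fvec p)⟫_ℂ =
      D.beta σ₀ q p' * (D.aCoef σ₀ p * (if p' = pA (F := F) σ₀ then 1 else 0) +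
        (if p = pA (F := F) σ₀ then 0 else (if p' = p then 1 else 0))) := by
    intro p' _
    rw [inner_smul_left, Complex.conj_conj, inner_add_right, inner_smul_right, inner_fvec]
    congr 2
    split_ifs with h1 h2
    · exact inner_zero_right _
    · rw [inner_fvec, if_pos h2]
    · rw [inner_fvec, if_neg h2]
  rw [Finset.sum_congr rfl hterm]
  by_cases hpA : p = pA (F := F) σ₀
  · rw [Finset.sum_eq_single_of_mem p hp]
    · rw [if_pos hpA, if_pos hpA, hpA, beta, if_pos rfl, aCoef_pA, mul_one, add_zero, mul_one]
    · intro p' _ hne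
      have hne' : p' ≠ pA (F := F) σ₀ := fun h => hne (h.trans hpA.symm)
      rw [if_neg hne', if_pos hpA, mul_zero, add_zero, mul_zero]
  · have hsum : ∀ p' ∈ pairs1 F,
        D.beta σ₀ q p' * (D.aCoef σ₀ p * (if p' = pA (F := F) σ₀ then 1 else 0) +
          (if p = pA (F := F) σ₀ then 0 else (if p' = p then 1 else 0))) =
        (if p' = pA (F := F) σ₀ then D.M σ₀ (pA (F := F) σ₀) q * D.aCoef σ₀ p else 0) +
          (if p' = p then D.M σ₀ p q - D.M σ₀ (pA (F := F) σ₀) q * D.aCoef σ₀ p else 0) := by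
      intro p' _
      by_cases h1 : p' = pA (F := F) σ₀
      · subst h1
        simp only [if_true, if_neg hpA, if_neg (Ne.symm hpA), beta, mul_one, add_zero]
      · by_cases h2 : p' = p
        · subst h2
          simp only [if_neg h1, if_true, beta, mul_zero, zero_add, mul_one]
        · simp only [if_neg h1, if_neg h2, if_neg hpA, mul_zero, add_zero]
    rw [Finset.sum_congr rfl hsum, Finset.sum_add_distrib, Finset.sum_ite_eq', Finset.sum_ite_eq',
      if_pos (pA_mem_pairs1 σ₀), if_pos hp]
    ring

end WitData

end Summit.Ventures.HodgeRepro2.T6.N1Wit
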